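import Summits.RiemannHypothesis.RiemannHypothesis.Theorems.SuzukiPhiExistence
import Mathlib.Analysis.Normed.Operator.Compact.FredholmAlternative

/-!
# SuzukiPhiFredholm — Suzuki's Lemma 3.3 IN FULL: (3.4) is uniquely solvable on every CLEAN window
# (`NoUnitEigenvalue`, Suzuki's (K5)), by the Fredholm alternative (column DBR; RH-FREE, ζ-free operator theory)

LINE 1 — LABEL: RH-FREE (K-general functional analysis; instances for Suzuki's single-operator kernels `K_θ` on the
cell's KERNEL clean windows); bears_on LADDER-RH B-P(P2)/(P3) (dictionary «clean window ⇒ canonical-system data exist»,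
now with the column's own currency `NoUnitEigenvalue`/`CleanUpTo` as hypothesis).  WHAT THIS IS NOT: no new clean window,
no positivity, nothing about zeros of `ζ`; nothing here bears on the truth of RH.

`Theorems/SuzukiPhiExistence` ([rh-dbr-eng] g7) solved Suzuki's integral equation
`X(x) + ε∫_{(−∞,t]}K(x+y)X(y)dy = K(x+t)` (`x ≤ t`; JFA 281 (2021) 109116, (3.4)) on CONTRACTION windows (`‖𝖪[t]‖ < 1`,
Neumann series).  The printed Lemma 3.3 assumes only Suzuki's (K5) — `±1` are not eigenvalues of `𝖪[t]` — and invokes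
the FREDHOLM ALTERNATIVE.  Mathlib now has it for compact operators over any nontrivially normed field
(`IsCompactOperator.hasEigenvalue_or_mem_resolventSet`), and the window operator is compact
(`Literature.Analysis.OperatorTheory.isCompactOperator_l2KernelOp`, Reed–Simon VI.23), so this file proves Lemma 3.3 in
the printed generality, with (K5) in the tree's form `NoUnitEigenvalue K t`:
* `isUnit_one_add_smul_of_noUnitEigenvalue` — `NoUnitEigenvalue K t ⇒ 1 + ε𝖪[t]` is invertible on `L²(−t,t)` (`ε = ±1`):
  an eigenvector of `ε𝖪[t]` for `−1` would be an `L²` function with `𝖪[t]f = ∓f` a.e., excluded by (K5);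
* `exists_isSuzukiPhiSolution_of_isUnit`, `isSuzukiPhiSolution_ae_unique_of_isUnit` — existence / a.e.-uniqueness of
  (3.4) from invertibility of `1 + ε𝖪[t]` alone (the `L²` class is turned into the pointwise representative
  `X(x) = K(x+t) − ε∫_{(−t,t)}K(x+y)X₀(y)dy`, as in the contraction file);
* `exists_isSuzukiPhiSolution_of_noUnitEigenvalue`, `isSuzukiPhiSolution_ae_unique_of_noUnitEigenvalue`,
  `isSuzukiPhiSolution_suzukiPhiExt_of_noUnitEigenvalue`, `eq_suzukiPhiExt_of_noUnitEigenvalue` — LEMMA 3.3 on every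
  clean window, and choice-freeness of the tree's `suzukiPhiExt`;
Continuity of `φ^ε(t,·)` and the instances for Suzuki's kernels `K_θ` on the cell's kernel clean windows
(`CleanUpTo`, the universal polar law `t ≤ (θ−1)/28`) are in `Theorems/SuzukiPhiFredholmWindows`.

References: [Su21] M. Suzuki, J. Funct. Anal. 281 (2021) 109116, §3.1 (K5), §3.3 Lemma 3.3, (3.4)–(3.8); M. Reed, B. Simon,
*Methods of Modern Mathematical Physics I*, Thm VI.14 (Fredholm alternative) and Thm VI.23.
-/

noncomputable section

-- D-0017: `Summit.<S>.<S>.…` is the designed namespace of a single-problem summit.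
set_option linter.dupNamespace false

open MeasureTheory Set Filter Topology

namespace Summit.RiemannHypothesis.RiemannHypothesis.Theorems.SuzukiPhiExistence

open Literature.NumberTheory.LFunctions Literature.Analysis.OperatorTheory
open Summit.RiemannHypothesis.RiemannHypothesis.Theorems.SuzukiWindowsDoorTempleGalerkin (memLp_winKernel exists_winOp)

variable {K : ℝ → ℝ} {t ε : ℝ}

/-! ## §1 (K5) ⇒ `1 + ε𝖪[t]` is invertible (Fredholm alternative) -/

/-- **RH-FREE · FREDHOLM STEP**: for a continuous kernel `K`, `ε = ±1`, and a window `(−t,t)` on which `±1` are not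
eigenvalues of `𝖪[t]` (`NoUnitEigenvalue K t`, Suzuki's (K5)), the operator `1 + ε𝖪[t]` is a unit of the algebra of
bounded operators on `L²(−t,t)` — for ANY bounded `A` with the kernel formula a.e. (such `A` is compact, Reed–Simon VI.23;
then `IsCompactOperator.hasEigenvalue_or_mem_resolventSet` at `(volume.restrict (Ioo (-t) t)) = −1`). -/
theorem isUnit_one_add_smul_of_noUnitEigenvalue (hK : Continuous K) (hε : ε = 1 ∨ ε = -1) (hN : NoUnitEigenvalue K t)
    {A : Lp ℝ 2 (volume.restrict (Ioo (-t) t)) →L[ℝ] Lp ℝ 2 (volume.restrict (Ioo (-t) t))}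
    (hA : ∀ φ : Lp ℝ 2 (volume.restrict (Ioo (-t) t)),
      (A φ : ℝ → ℝ) =ᵐ[volume.restrict (Ioo (-t) t)] fun x => ∫ y in Ioo (-t) t, K (x + y) * φ y) :
    IsUnit (1 + ε • A) := by
  have hcpt : IsCompactOperator A := isCompactOperator_l2KernelOp (memLp_winKernel hK t) hA
  have hcT : IsCompactOperator (ε • A) := hcpt.smul ε
  rcases hcT.hasEigenvalue_or_mem_resolventSet (μ := (-1 : ℝ)) (by norm_num) with h | h
  · exfalso
    obtain ⟨ψ, hψ⟩ := h.exists_hasEigenvector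
    have hψ0 : ψ ≠ 0 := hψ.2
    have heq : ε • A ψ = -ψ := by
      have h1 := hψ.apply_eq_smul
      simpa using h1
    have hεsq : ε * ε = 1 := by rcases hε with rfl | rfl <;> norm_num
    have hAψ : A ψ = (-ε) • ψ := by
      have h1 : ε • (ε • A ψ) = ε • (-ψ) := by rw [heq]
      rw [smul_smul, hεsq, one_smul, smul_neg, ← neg_smul] at h1
      exact h1
    -- the `L²` function `ψ` is then an a.e. eigenfunction of the kernel operator for the unit eigenvalue `−ε`
    have hf : MemLp (ψ : ℝ → ℝ) 2 (volume.restrict (Ioo (-t) t)) := Lp.memLp ψ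
    have heig : ∀ᵐ x ∂(volume.restrict (Ioo (-t) t)), ∫ y in Ioo (-t) t, K (x + y) * ψ y = (-ε) * ψ x := by
      have h1 : (↑(A ψ) : ℝ → ℝ) =ᵐ[(volume.restrict (Ioo (-t) t))] fun x ↦ (-ε) * ψ x := by
        rw [hAψ]
        filter_upwards [Lp.coeFn_smul (-ε) ψ] with x hx
        rw [hx, Pi.smul_apply, smul_eq_mul]
      filter_upwards [hA ψ, h1] with x e1 e2
      rw [← e1, e2]
    have hε' : (-ε) = 1 ∨ (-ε) = -1 := by rcases hε with rfl | rfl <;> norm_num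
    have h0 : (ψ : ℝ → ℝ) =ᵐ[(volume.restrict (Ioo (-t) t))] 0 := hN (-ε) hε' (ψ : ℝ → ℝ) hf heig
    exact hψ0 (Lp.ext (h0.trans
      (Lp.coeFn_zero (E := ℝ) (p := 2) (μ := (volume.restrict (Ioo (-t) t)))).symm))
  · rw [spectrum.mem_resolventSet_iff] at h
    have e : (algebraMap ℝ (Lp ℝ 2 (volume.restrict (Ioo (-t) t)) →L[ℝ] Lp ℝ 2 (volume.restrict (Ioo (-t) t))) (-1) - ε • A) =
        -(1 + ε • A) := by
      rw [map_neg, map_one]; abel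
    rw [e, IsUnit.neg_iff] at h
    exact h

/-! ## §2 Existence and uniqueness of (3.4) from invertibility of `1 + ε𝖪[t]` -/

/-- RH-FREE.  **Existence from invertibility**: `K` continuous with `K = 0` on `(−∞,0]`, `A` any bounded operator on
`L²(−t,t)` with the kernel formula, `1 + εA` invertible ⇒ (3.4) has a solution (satisfying the equation at every
`x ≤ t`, vanishing on `(−∞,−t]`). -/
theorem exists_isSuzukiPhiSolution_of_isUnit (hK : Continuous K) (hK0 : ∀ u : ℝ, u ≤ 0 → K u = 0)
    {A : Lp ℝ 2 (volume.restrict (Ioo (-t) t)) →L[ℝ] Lp ℝ 2 (volume.restrict (Ioo (-t) t))}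
    (hA : ∀ φ : Lp ℝ 2 (volume.restrict (Ioo (-t) t)),
      (A φ : ℝ → ℝ) =ᵐ[volume.restrict (Ioo (-t) t)] fun x => ∫ y in Ioo (-t) t, K (x + y) * φ y)
    (hu : IsUnit (1 + ε • A)) :
    ∃ X : ℝ → ℝ, IsSuzukiPhiSolution K ε t X := by
  haveI : IsFiniteMeasure (volume.restrict (Ioo (-t) t)) := by infer_instance
  -- the right-hand side `x ↦ K(x+t)` as an element of `L²(−t,t)`
  obtain ⟨CK, hCK⟩ := (isCompact_Icc (a := (0 : ℝ)) (b := 2 * t)).exists_bound_of_continuousOn hK.continuousOn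
  have hbm : MemLp (fun x : ℝ ↦ K (x + t)) 2 (volume.restrict (Ioo (-t) t)) := by
    have hae : AEStronglyMeasurable (fun x : ℝ ↦ K (x + t)) (volume.restrict (Ioo (-t) t)) :=
      (hK.comp (continuous_id.add continuous_const)).aestronglyMeasurable
    have htop : MemLp (fun x : ℝ ↦ K (x + t)) ⊤ (volume.restrict (Ioo (-t) t)) := by
      refine memLp_top_of_bound hae CK ?_
      refine (ae_restrict_iff' measurableSet_Ioo).2 (Eventually.of_forall fun x hx ↦ ?_)
      exact hCK (x + t) ⟨by linarith [hx.1], by linarith [hx.2]⟩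
    exact htop.mono_exponent le_top
  set b : Lp ℝ 2 (volume.restrict (Ioo (-t) t)) := hbm.toLp _ with hb
  obtain ⟨u, huval⟩ := hu
  set T : Lp ℝ 2 (volume.restrict (Ioo (-t) t)) →L[ℝ] Lp ℝ 2 (volume.restrict (Ioo (-t) t)) := ε • A with hT
  set X₀ : Lp ℝ 2 (volume.restrict (Ioo (-t) t)) :=
    (↑u⁻¹ : Lp ℝ 2 (volume.restrict (Ioo (-t) t)) →L[ℝ] Lp ℝ 2 (volume.restrict (Ioo (-t) t))) b with hX₀
  have hsolve : X₀ + T X₀ = b := by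
    have h1 : ((u : Lp ℝ 2 (volume.restrict (Ioo (-t) t)) →L[ℝ] Lp ℝ 2 (volume.restrict (Ioo (-t) t))) * ↑u⁻¹) b
        = b := by
      rw [Units.mul_inv, one_apply_eq_self]
    rw [mul_apply_eq_comp, huval, add_apply, one_apply_eq_self] at h1
    rw [hX₀]
    exact h1
  -- a.e. form of the equation on the window
  have hae : ∀ᵐ x ∂(volume.restrict (Ioo (-t) t)),
      X₀ x + ε * ∫ y in Ioo (-t) t, K (x + y) * X₀ y = K (x + t) := by
    have h1 : (↑(X₀ + T X₀) : ℝ → ℝ) =ᵐ[(volume.restrict (Ioo (-t) t))] (b : ℝ → ℝ) := by rw [hsolve]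
    have h2 := Lp.coeFn_add X₀ (T X₀)
    have h3 : (↑(T X₀) : ℝ → ℝ) =ᵐ[(volume.restrict (Ioo (-t) t))] fun x ↦ ε * (A X₀ : ℝ → ℝ) x := by
      rw [hT, smul_apply]
      filter_upwards [Lp.coeFn_smul ε (A X₀)] with x hx
      rw [hx, Pi.smul_apply, smul_eq_mul]
    have h4 := hA X₀
    have h5 : (b : ℝ → ℝ) =ᵐ[(volume.restrict (Ioo (-t) t))] fun x ↦ K (x + t) := hbm.coeFn_toLp
    filter_upwards [h1, h2, h3, h4, h5] with x e1 e2 e3 e4 e5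
    rw [← e5, ← e1, e2, Pi.add_apply, e3, e4]
  -- the pointwise representative
  set X : ℝ → ℝ := fun x ↦ K (x + t) - ε * ∫ y in Ioo (-t) t, K (x + y) * X₀ y with hXdef
  have hXX₀ : (fun x ↦ X x) =ᵐ[(volume.restrict (Ioo (-t) t))] (X₀ : ℝ → ℝ) := by
    filter_upwards [hae] with x hx
    simp only [hXdef]
    linarith
  have hint : ∀ x : ℝ, ∫ y in Ioo (-t) t, K (x + y) * X y = ∫ y in Ioo (-t) t, K (x + y) * X₀ y := by
    intro x
    refine integral_congr_ae ?_
    filter_upwards [hXX₀] with y hy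
    rw [hy]
  refine ⟨X, ?_, fun x hx ↦ ?_⟩
  · -- `X ∈ L²((−∞,t])`: `X = 1_{(−t,t)} X₀` a.e. on `(−∞,t]`
    have hXμ : MemLp X 2 (volume.restrict (Ioo (-t) t)) := (Lp.memLp X₀).ae_eq hXX₀.symm
    have hind : MemLp ((Ioo (-t) t).indicator X) 2 (volume.restrict (Iic t)) := by
      have hI : Ioo (-t) t ∩ Iic t = Ioo (-t) t := inter_eq_left.2 fun y hy ↦ (hy.2.le : y ≤ t)
      rw [memLp_indicator_iff_restrict measurableSet_Ioo, Measure.restrict_restrict measurableSet_Ioo, hI]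
      exact hXμ
    refine hind.ae_eq ?_
    have hne : ∀ᵐ x ∂(volume : Measure ℝ), x ≠ t := by
      have h0 : ({t} : Set ℝ)ᶜ ∈ ae (volume : Measure ℝ) := compl_mem_ae_iff.2 (measure_singleton t)
      filter_upwards [h0] with x hx
      simpa using hx
    filter_upwards [ae_restrict_mem measurableSet_Iic, ae_restrict_of_ae (s := Iic t) hne] with x hx hxt
    by_cases hxm : x ∈ Ioo (-t) t
    · rw [indicator_of_mem hxm]
    · rw [indicator_of_notMem hxm]
      have hxle : x ≤ -t := by
        by_contra h
        exact hxm ⟨lt_of_not_ge h, lt_of_le_of_ne hx hxt⟩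
      show 0 = X x
      simp only [hXdef]
      rw [hK0 _ (by linarith), setIntegral_Ioo_kernel_mul_eq_zero hK0 hxle]
      ring
  · -- the equation at every `x ≤ t`
    rw [setIntegral_Iic_kernel_mul_eq hK0 hx, hint x]
    simp only [hXdef]
    ring

/-- RH-FREE.  **Uniqueness from invertibility**: under the same hypotheses (and `t ≥ 0`), two solutions of (3.4) agree
almost everywhere on `(−∞,t]`. -/
theorem isSuzukiPhiSolution_ae_unique_of_isUnit (hK : Continuous K) (hK0 : ∀ u : ℝ, u ≤ 0 → K u = 0) (ht : 0 ≤ t)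
    {A : Lp ℝ 2 (volume.restrict (Ioo (-t) t)) →L[ℝ] Lp ℝ 2 (volume.restrict (Ioo (-t) t))}
    (hA : ∀ φ : Lp ℝ 2 (volume.restrict (Ioo (-t) t)),
      (A φ : ℝ → ℝ) =ᵐ[volume.restrict (Ioo (-t) t)] fun x => ∫ y in Ioo (-t) t, K (x + y) * φ y)
    (hu : IsUnit (1 + ε • A)) {X Y : ℝ → ℝ} (hX : IsSuzukiPhiSolution K ε t X) (hY : IsSuzukiPhiSolution K ε t Y) :
    X =ᵐ[volume.restrict (Iic t)] Y := by
  haveI : IsFiniteMeasure (volume.restrict (Ioo (-t) t)) := by infer_instance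
  obtain ⟨u, huval⟩ := hu
  set T : Lp ℝ 2 (volume.restrict (Ioo (-t) t)) →L[ℝ] Lp ℝ 2 (volume.restrict (Ioo (-t) t)) := ε • A with hT
  -- the difference `D = X − Y`
  set D : ℝ → ℝ := fun x ↦ X x - Y x with hD
  have hDmem : MemLp D 2 (volume.restrict (Iic t)) := hX.1.sub hY.1
  have hDμ : MemLp D 2 (volume.restrict (Ioo (-t) t)) :=
    hDmem.mono_measure (Measure.restrict_mono (fun y hy ↦ (hy.2.le : y ≤ t)) le_rfl)
  have hDeq : ∀ x : ℝ, x ≤ t → D x + ε * ∫ y in Ioo (-t) t, K (x + y) * D y = 0 := by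
    intro x hx
    have e1 := hX.2 x hx
    have e2 := hY.2 x hx
    rw [setIntegral_Iic_kernel_mul_eq hK0 hx] at e1 e2
    have hXμ : MemLp X 2 (volume.restrict (Ioo (-t) t)) :=
      hX.1.mono_measure (Measure.restrict_mono (fun y hy ↦ (hy.2.le : y ≤ t)) le_rfl)
    have hYμ : MemLp Y 2 (volume.restrict (Ioo (-t) t)) :=
      hY.1.mono_measure (Measure.restrict_mono (fun y hy ↦ (hy.2.le : y ≤ t)) le_rfl)
    have hsub : ∫ y in Ioo (-t) t, K (x + y) * D y =
        (∫ y in Ioo (-t) t, K (x + y) * X y) - ∫ y in Ioo (-t) t, K (x + y) * Y y := by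
      rw [← integral_sub (integrableOn_kernel_mul_Ioo hK hXμ x) (integrableOn_kernel_mul_Ioo hK hYμ x)]
      refine integral_congr_ae (Eventually.of_forall fun y ↦ ?_)
      simp only [hD]
      ring
    rw [hsub]
    simp only [hD]
    linarith
  set d : Lp ℝ 2 (volume.restrict (Ioo (-t) t)) := hDμ.toLp D with hd
  have hd_ae : (d : ℝ → ℝ) =ᵐ[(volume.restrict (Ioo (-t) t))] D := hDμ.coeFn_toLp
  have hkill : (u : Lp ℝ 2 (volume.restrict (Ioo (-t) t)) →L[ℝ] Lp ℝ 2 (volume.restrict (Ioo (-t) t))) d = 0 := by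
    rw [huval]
    refine Lp.ext ?_
    have h2 := Lp.coeFn_add d (T d)
    have h3 : (↑(T d) : ℝ → ℝ) =ᵐ[(volume.restrict (Ioo (-t) t))] fun x ↦ ε * (A d : ℝ → ℝ) x := by
      rw [hT, smul_apply]
      filter_upwards [Lp.coeFn_smul ε (A d)] with x hx
      rw [hx, Pi.smul_apply, smul_eq_mul]
    have h4 := hA d
    have hint : ∀ x : ℝ, ∫ y in Ioo (-t) t, K (x + y) * d y = ∫ y in Ioo (-t) t, K (x + y) * D y := by
      intro x
      refine integral_congr_ae ?_
      filter_upwards [hd_ae] with y hy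
      rw [hy]
    have hmem : ∀ᵐ x ∂(volume.restrict (Ioo (-t) t)), x ∈ Ioo (-t) t := ae_restrict_mem measurableSet_Ioo
    rw [add_apply, one_apply_eq_self]
    filter_upwards [h2, h3, h4, hd_ae, hmem,
      Lp.coeFn_zero (E := ℝ) (p := 2) (μ := (volume.restrict (Ioo (-t) t)))] with x e2 e3 e4 e5 hx e0
    rw [e2, Pi.add_apply, e3, e4, hint x, e5, e0, Pi.zero_apply]
    exact hDeq x hx.2.le
  have hd0 : d = 0 := by
    have h1 : ((↑u⁻¹ : Lp ℝ 2 (volume.restrict (Ioo (-t) t)) →L[ℝ] Lp ℝ 2 (volume.restrict (Ioo (-t) t))) * (u : Lp ℝ 2 (volume.restrict (Ioo (-t) t)) →L[ℝ] Lp ℝ 2 (volume.restrict (Ioo (-t) t)))) d = d := by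
      rw [Units.inv_mul, one_apply_eq_self]
    rw [mul_apply_eq_comp, hkill, map_zero] at h1
    exact h1.symm
  have hDae : ∀ᵐ x ∂(volume.restrict (Ioo (-t) t)), D x = 0 := by
    have h0 : (d : ℝ → ℝ) =ᵐ[(volume.restrict (Ioo (-t) t))] 0 := by
      rw [hd0]; exact Lp.coeFn_zero (E := ℝ) (p := 2) (μ := (volume.restrict (Ioo (-t) t)))
    filter_upwards [hd_ae, h0] with x e1 e2
    rw [← e1, e2, Pi.zero_apply]
  have hsplit : volume.restrict (Iic t) = volume.restrict (Iic (-t) ∪ Ioc (-t) t) := by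
    rw [Iic_union_Ioc_eq_Iic (by linarith : -t ≤ t)]
  have hgoal : ∀ᵐ x ∂(volume.restrict (Iic t)), D x = 0 := by
    rw [hsplit, ae_restrict_union_iff]
    constructor
    · refine (ae_restrict_iff' measurableSet_Iic).2 (Eventually.of_forall fun x hx ↦ ?_)
      simp only [hD]
      rw [isSuzukiPhiSolution_eq_zero_of_le_neg hK0 ht hX hx,
        isSuzukiPhiSolution_eq_zero_of_le_neg hK0 ht hY hx, sub_zero]
    · rw [← Measure.restrict_congr_set (Ioo_ae_eq_Ioc (μ := (volume : Measure ℝ)))]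
      exact hDae
  filter_upwards [hgoal] with x hx
  simp only [hD] at hx
  exact sub_eq_zero.1 hx

/-! ## §3 Lemma 3.3 on every clean window -/

/-- **RH-FREE · SUZUKI'S LEMMA 3.3, EXISTENCE** (JFA 281 (2021) 109116): for a continuous kernel `K` vanishing on
`(−∞,0]`, `ε = ±1`, and a window `(−t,t)` free of the eigenvalues `±1` (`NoUnitEigenvalue K t`, (K5)), the integral
equation (3.4) has a solution in `L²(−∞,t)` satisfying it at every `x ≤ t`. -/
theorem exists_isSuzukiPhiSolution_of_noUnitEigenvalue (hK : Continuous K) (hK0 : ∀ u : ℝ, u ≤ 0 → K u = 0)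
    (hε : ε = 1 ∨ ε = -1) (hN : NoUnitEigenvalue K t) : ∃ X : ℝ → ℝ, IsSuzukiPhiSolution K ε t X := by
  obtain ⟨A, hA⟩ := exists_winOp hK t
  exact exists_isSuzukiPhiSolution_of_isUnit hK hK0 hA (isUnit_one_add_smul_of_noUnitEigenvalue hK hε hN hA)

/-- **RH-FREE · SUZUKI'S LEMMA 3.3, UNIQUENESS**: on a clean window (`t ≥ 0`) two solutions of (3.4) agree a.e. on
`(−∞,t]`. -/
theorem isSuzukiPhiSolution_ae_unique_of_noUnitEigenvalue (hK : Continuous K) (hK0 : ∀ u : ℝ, u ≤ 0 → K u = 0)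
    (ht : 0 ≤ t) (hε : ε = 1 ∨ ε = -1) (hN : NoUnitEigenvalue K t) {X Y : ℝ → ℝ}
    (hX : IsSuzukiPhiSolution K ε t X) (hY : IsSuzukiPhiSolution K ε t Y) : X =ᵐ[volume.restrict (Iic t)] Y := by
  obtain ⟨A, hA⟩ := exists_winOp hK t
  exact isSuzukiPhiSolution_ae_unique_of_isUnit hK hK0 ht hA (isUnit_one_add_smul_of_noUnitEigenvalue hK hε hN hA)
    hX hY

/-- RH-FREE.  On a clean window the tree's extended solution `suzukiPhiExt K ε t` ((3.7)) IS a solution of (3.4). -/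
theorem isSuzukiPhiSolution_suzukiPhiExt_of_noUnitEigenvalue (hK : Continuous K) (hK0 : ∀ u : ℝ, u ≤ 0 → K u = 0)
    (hε : ε = 1 ∨ ε = -1) (hN : NoUnitEigenvalue K t) : IsSuzukiPhiSolution K ε t (suzukiPhiExt K ε t) :=
  isSuzukiPhiSolution_suzukiPhiExt (exists_isSuzukiPhiSolution_of_noUnitEigenvalue hK hK0 hε hN)

/-- **RH-FREE · CHOICE-FREENESS on clean windows**: every solution of (3.4) equals `suzukiPhiExt K ε t` at every
`x ≤ t`. -/
theorem eq_suzukiPhiExt_of_noUnitEigenvalue (hK : Continuous K) (hK0 : ∀ u : ℝ, u ≤ 0 → K u = 0) (ht : 0 ≤ t)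
    (hε : ε = 1 ∨ ε = -1) (hN : NoUnitEigenvalue K t) {X : ℝ → ℝ} (hX : IsSuzukiPhiSolution K ε t X) {x : ℝ}
    (hx : x ≤ t) : X x = suzukiPhiExt K ε t x :=
  hX.eq_suzukiPhiExt (fun _ _ h1 h2 ↦ isSuzukiPhiSolution_ae_unique_of_noUnitEigenvalue hK hK0 ht hε hN h1 h2) hx

end Summit.RiemannHypothesis.RiemannHypothesis.Theorems.SuzukiPhiExistence

end
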